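import Summits.BirchSwinnertonDyer.Rank1Residual.X5.TwoAdicTargetsJunk
import HarnessLib

/-!
# O1 (X5 at `p = 2`, non-CM): the main-conjecture side at `2`, GUARDED (refuter repairs R1/R2)

HONEST FRAMING (cell `b2b-bsdres`, run/shared/lean/b2b/bsd-rank1-residual/, verbatim in every
file): the goal of the cell is to DELETE the COMBINATION-SHAPED residual classes of the
Birch–Swinnerton-Dyer formula for ALL analytic-rank `≤ 1` elliptic curves over `ℚ` — "full BSD
formula for every rank `≤ 1` curve in class `C`" assembled STRICTLY from published theorems — so
that the rank-`≤ 1` remainder becomes exactly the CONSTRUCTION-SHAPED classes, which are TYPED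
(missing-input `Prop`s), NOT attempted. This is not "finishing BSD". Research routes; no claim
beyond stated classes; census output = EVIDENCE, never a Literature fact; nothing here is booked;
no mark of RESIDUAL-MAP §I moves.

Typer file 6 of the O1 class-closure folder (seat cc-typer-4). The o1 refuter (gen 2, T1 pass,
REFUTER-O1.md §7.1; kernel record `X5/TwoAdicTargetsJunk.lean`) classed the E2 residue item
`O1.MainConjectureLowerDivisibilityAtTwo W` of `X5/TwoAdicTargets.lean` as MISSTATED: stated with no
`IsOrdinaryAt W 2` guard, it is junk-TRUE on the 2 739 residue classes with `2 ∣ a₂`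
(`unitRoot W 2 = 0`, `padicLFunction f 0 = 0`, witness `g = 0`). Theorems files are append-only, so
the repair is filed HERE under a new name, and the old item is related to it exactly:

* `O1.MainConjectureLowerDivisibilityAtTwoOrd W` (`@[conjecture]`) — repair R1: the same body behind
  `IsOrdinaryAt W 2 →`. Content-bearing on `CellGoodOrd` only (611 residue classes); OPEN; nothing
  in print at `2` (Skinner–Urban 2014 and every later ordinary main conjecture keep `p` odd).
* `…Ord_of_mainConjectureLowerDivisibilityAtTwo` (old ⇒ new, trivially) and
  `mainConjectureLowerDivisibilityAtTwo_iff_ord_of_not_cellAddv` (old ⟺ new OFF the additive cell,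
  by the refuter's junk theorems; on `CellAddv` the old item's status is unknown junk — a spurious
  unit root of `X² - X + 2` may exist — so no equivalence is claimed there).
* `…Ord_of_mazurMainConjecture` — repair R2: the Eisenstein half follows from the cell's
  `MazurMainConjecture W 2` taken UNDER THE GUARD `IsOrdinaryAt W 2` (the unguarded
  `MazurMainConjecture W 2` is false whenever `2 ∣ a₂`, `not_mazurMainConjecture_of_dvd_frobeniusTrace`).

Nothing here is a Literature fact; nothing is booked; O1 stays OPEN.
-/

noncomputable section

open scoped Classical MatrixGroups ModularForm

open CongruenceSubgroup WeierstrassCurve Literature.NumberTheory.EllipticCurves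
  Literature.NumberTheory.EllipticCurves.ModularForms Literature.NumberTheory.EllipticCurves.Rank1Residual
  Literature.NumberTheory.EllipticCurves.Rank1Residual.Typed
  Summit.BirchSwinnertonDyer.BirchSwinnertonDyer.Theorems.Rank1ResidualX1Defs

set_option autoImplicit false

namespace Summit.BirchSwinnertonDyer.Rank1Residual.X5.O1

variable (W : WeierstrassCurve ℚ) [W.IsElliptic] [W.IsGloballyMinimal]

/-- **E2 IRREDUCIBLE RESIDUE, GUARDED (repair R1 of `O1.MainConjectureLowerDivisibilityAtTwo`) —
the Eisenstein ("Skinner–Urban") half of the cyclotomic main conjecture AT a GOOD ORDINARY `2`,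
Néron normalisation**: for the cyclotomic `ℤ₂`-extension, IF `E` is good ordinary at `2`, then for
the newform `f` at level `N_E`, the rational `ϖ` with `ϖ·Ω_E = Ω⁺_f` and every dual datum `D`:
`ϖ·L₂(f, α) = ι g` for some `g ∈ char_Λ X(E/ℚ_∞)`, i.e. `char_Λ X ∣ 𝓛₂^{MSD}(E)` in `Λ`. NOTHING in
print or announced at `p = 2` for a non-CM curve: Skinner–Urban 2014 p. 13 "Throughout this paper
`p` is a fixed odd prime", and every later ordinary main conjecture (Wan, Castella–Grossi–Skinner,
Burungale–Castella–Skinner, Keller–Yin) keeps `p` odd. Content-bearing exactly on `CellGoodOrd`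
(o1 refuter gen 2, §7.1). OPEN; nothing asserted.
[cite: SkinnerUrban2014, Thm. 3.6.9 / §3.6 (p odd; shape only; nothing asserted)] -/
@[conjecture] def MainConjectureLowerDivisibilityAtTwoOrd : Prop :=
  ∀ (κ : ZpExtension ℚ 2) (γ : Field.absoluteGaloisGroup ℚ),
      κ.IsCyclotomic → κ.IsTopGenerator γ → IsCyclotomicVariable 2 γ → IsOrdinaryAt W 2 →
    ∀ [NeZero (W.conductorNorm ℤ)] (f : CuspForm (Gamma0 (W.conductorNorm ℤ)) 2),
      IsNewformOf W f → ∀ (ϖ : ℚ), (ϖ : ℝ) * W.realPeriodRat = plusPeriod f →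
    ∀ (D : W.SelmerDualData κ γ), ∃ g ∈ D.charIdeal,
        iwasawaToPowerSeries 2 g =
          PowerSeries.C (ϖ : ℚ_[2]) * padicLFunction f (unitRoot W 2 : ℚ_[2])

omit [W.IsElliptic] in
/-- Old (unguarded) ⇒ new (guarded), trivially. [folklore] -/
theorem mainConjectureLowerDivisibilityAtTwoOrd_of_mainConjectureLowerDivisibilityAtTwo
    (h : MainConjectureLowerDivisibilityAtTwo W) : MainConjectureLowerDivisibilityAtTwoOrd W :=
  fun κ γ hκ hγ hγ' _ _ f hf ϖ hϖ D => h κ γ hκ hγ hγ' f hf ϖ hϖ D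

omit [W.IsElliptic] in
/-- On the good ordinary cell the two items say the same thing (`CellGoodOrd W` IS
`IsOrdinaryAt W 2`, definitionally). [folklore] -/
theorem mainConjectureLowerDivisibilityAtTwo_iff_ord_of_cellGoodOrd (hgo : CellGoodOrd W) :
    MainConjectureLowerDivisibilityAtTwo W ↔ MainConjectureLowerDivisibilityAtTwoOrd W :=
  ⟨mainConjectureLowerDivisibilityAtTwoOrd_of_mainConjectureLowerDivisibilityAtTwo W,
    fun h κ γ hκ hγ hγ' _ f hf ϖ hϖ D => h κ γ hκ hγ hγ' hgo f hf ϖ hϖ D⟩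

/-- **Old ⟺ new off the additive cell.** On `CellGoodOrd` the guard is satisfied; on
`CellGoodSS ∪ CellMultSplit ∪ CellMultNonsplit` the old item holds by junk
(`mainConjectureLowerDivisibilityAtTwo_of_not_goodOrd_of_not_addv`, refuter) and the new one holds
vacuously (`2 ∣ a₂` contradicts the guard). On `CellAddv` nothing is claimed. [folklore] -/
theorem mainConjectureLowerDivisibilityAtTwo_iff_ord_of_not_cellAddv (had : ¬ CellAddv W) :
    MainConjectureLowerDivisibilityAtTwo W ↔ MainConjectureLowerDivisibilityAtTwoOrd W := by
  refine ⟨mainConjectureLowerDivisibilityAtTwoOrd_of_mainConjectureLowerDivisibilityAtTwo W,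
    fun h => ?_⟩
  by_cases hgo : CellGoodOrd W
  · exact (mainConjectureLowerDivisibilityAtTwo_iff_ord_of_cellGoodOrd W hgo).mpr h
  · exact mainConjectureLowerDivisibilityAtTwo_of_not_goodOrd_of_not_addv W hgo had

/-- **Repair R2.** The guarded residue is the Eisenstein HALF of the cell's main-conjecture
obligation at `2` taken under the guard: `(IsOrdinaryAt W 2 → MazurMainConjecture W 2) → …Ord`.
(The unguarded `MazurMainConjecture W 2` is false off the ordinary locus,
`not_mazurMainConjecture_of_dvd_frobeniusTrace`.) Bookkeeping.
[cite: CastellaGrossiSkinner2025, Introduction (MC) (shape)] -/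
theorem mainConjectureLowerDivisibilityAtTwoOrd_of_mazurMainConjecture
    (h : IsOrdinaryAt W 2 → MazurMainConjecture W 2) :
    MainConjectureLowerDivisibilityAtTwoOrd W := by
  intro κ γ hκ hγ hγ' hord _ f hf ϖ hϖ D
  obtain ⟨-, g, hchar, hι⟩ := h hord κ γ hκ hγ hγ' f hf ϖ hϖ D
  exact ⟨g, hchar ▸ Ideal.mem_span_singleton_self g, hι⟩

omit [W.IsElliptic] in
/-- The guard is not cosmetic: on the cells with `2 ∣ a₂` the guarded item holds VACUOUSLY (its
hypothesis `IsOrdinaryAt W 2` fails), so — exactly like the old item there — it carries no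
content; the difference is that it no longer PRETENDS to (refuter class "misstated" removed).
[folklore] -/
theorem mainConjectureLowerDivisibilityAtTwoOrd_of_two_dvd_frobeniusTrace
    (h2 : (2 : ℤ) ∣ W.frobeniusTrace 2) : MainConjectureLowerDivisibilityAtTwoOrd W :=
  fun _ _ _ _ _ hord => absurd h2 hord.2

end Summit.BirchSwinnertonDyer.Rank1Residual.X5.O1

end
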